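import Mathlib
import HarnessLib
import Summits.Ventures.LatticeQCDFlow.Exactness.SU2FTHMCTranslationCovariance
import Summits.Ventures.LatticeQCDFlow.Exactness.SU2ExactForceCovariance

/-!
# The EXACT force of a translation-invariant action is translation covariant; the `SU(2)` FT-HMC kernel with the exact-gradient force commutes with lattice translations — no force hypothesis left

HONEST FRAMING: exact (Metropolis-corrected) sampling algorithms for lattice gauge theory;
figures of merit are autocorrelation/cost numbers at stated couplings and volumes; no
continuum-physics claim.

Venture `LatticeQCDFlow` (cell pub-lqcd), topic `Exactness`; FANOUT row 14 (`eng-flowhmc`).  NEW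
WORK of the cell; nothing is cited as a fact; no number.  The translation twin of
`SU2ExactForceCovariance`: a translation `a : Site d L` re-indexes configurations
(`(V·a)(x, μ) = V(x+a, μ)`) and momenta (`(p·a)((x, μ), i) = p((x+a, μ), i)`).

* `su2Drift_translate_mul` — `exp(c p) · (V·a) = (exp(c (p·(−a))) · V)·a`;
  `ftAction_drift_translate` — for a translation-invariant `S̃`, `p ↦ S̃(exp(c p) · (V·a))` is
  `p ↦ S̃(exp(c p) · V)` precomposed with the coordinate permutation `p ↦ p·(−a)`;
* `single_translate` — the permutation sends the coordinate vector `e_q` to `e_(q·a)`;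
* **`su2ExactForce_translate`** — the exact force `g_κ V (q) = κ · fderiv ℝ (p ↦ S̃(exp(c p)·V)) 0 (e_q)`
  of EVERY translation-invariant `S̃` is translation covariant: `g_κ (V·a) = (g_κ V)·a` (chain rule
  through the continuous linear equivalence; no differentiability hypothesis);
* **`su2_fthmc_exactForce_conjKernel_translate`** — the engine's `SU(2)` FT-HMC kernel driven by the
  exact gradient of `S̃ = S∘F − log J` (member `F` translation equivariant, `J`, `S` translation
  invariant and measurable, `S̃` continuous) commutes with every lattice translation — the force
  hypothesis of `su2_fthmc_conjKernel_translate` discharged.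

NOT CLAIMED: translation-equivariance of the engine's parity-masked members (even translations
only; not typed); rotations/reflections; any number.
-/

noncomputable section

namespace Summit.Ventures.LatticeQCDFlow.Exactness

open WithLp Set MeasureTheory
open ProbabilityTheory ProbabilityTheory.Kernel
open Literature.MathematicalPhysics.QuantumFieldTheory
open scoped ENNReal Matrix

variable {d L : ℕ} [NeZero L]

omit [NeZero L] in
/-- `exp(c p) · (V·a) = (exp(c (p·(−a))) · V)·a` — the drift seen from translated data. -/
theorem su2Drift_translate_mul (a : Site d L) (c : ℝ) (p : ((Edge d L × Fin 3) → ℝ)) (V : GaugeConfig d L (Matrix.specialUnitaryGroup (Fin 2) ℂ)) :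
    (fun ℓ : Edge d L => gaussUnit (toLp 2
          ![Real.cos (c * Real.sqrt (p (ℓ, 0) ^ 2 + p (ℓ, 1) ^ 2 + p (ℓ, 2) ^ 2)),
            c * Real.sinc (c * Real.sqrt (p (ℓ, 0) ^ 2 + p (ℓ, 1) ^ 2 + p (ℓ, 2) ^ 2)) * p (ℓ, 0),
            c * Real.sinc (c * Real.sqrt (p (ℓ, 0) ^ 2 + p (ℓ, 1) ^ 2 + p (ℓ, 2) ^ 2)) * p (ℓ, 1),
            c * Real.sinc (c * Real.sqrt (p (ℓ, 0) ^ 2 + p (ℓ, 1) ^ 2 + p (ℓ, 2) ^ 2)) * p (ℓ, 2)])) * (fun e : Edge d L => V (e.1 + a, e.2)) =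
      (fun e : Edge d L => (((fun ℓ : Edge d L => gaussUnit (toLp 2
          ![Real.cos (c * Real.sqrt ((fun q : Edge d L × Fin 3 => p ((q.1.1 - a, q.1.2), q.2)) (ℓ, 0) ^ 2 + (fun q : Edge d L × Fin 3 => p ((q.1.1 - a, q.1.2), q.2)) (ℓ, 1) ^ 2 + (fun q : Edge d L × Fin 3 => p ((q.1.1 - a, q.1.2), q.2)) (ℓ, 2) ^ 2)),
            c * Real.sinc (c * Real.sqrt ((fun q : Edge d L × Fin 3 => p ((q.1.1 - a, q.1.2), q.2)) (ℓ, 0) ^ 2 + (fun q : Edge d L × Fin 3 => p ((q.1.1 - a, q.1.2), q.2)) (ℓ, 1) ^ 2 + (fun q : Edge d L × Fin 3 => p ((q.1.1 - a, q.1.2), q.2)) (ℓ, 2) ^ 2)) * (fun q : Edge d L × Fin 3 => p ((q.1.1 - a, q.1.2), q.2)) (ℓ, 0),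
            c * Real.sinc (c * Real.sqrt ((fun q : Edge d L × Fin 3 => p ((q.1.1 - a, q.1.2), q.2)) (ℓ, 0) ^ 2 + (fun q : Edge d L × Fin 3 => p ((q.1.1 - a, q.1.2), q.2)) (ℓ, 1) ^ 2 + (fun q : Edge d L × Fin 3 => p ((q.1.1 - a, q.1.2), q.2)) (ℓ, 2) ^ 2)) * (fun q : Edge d L × Fin 3 => p ((q.1.1 - a, q.1.2), q.2)) (ℓ, 1),
            c * Real.sinc (c * Real.sqrt ((fun q : Edge d L × Fin 3 => p ((q.1.1 - a, q.1.2), q.2)) (ℓ, 0) ^ 2 + (fun q : Edge d L × Fin 3 => p ((q.1.1 - a, q.1.2), q.2)) (ℓ, 1) ^ 2 + (fun q : Edge d L × Fin 3 => p ((q.1.1 - a, q.1.2), q.2)) (ℓ, 2) ^ 2)) * (fun q : Edge d L × Fin 3 => p ((q.1.1 - a, q.1.2), q.2)) (ℓ, 2)])) * V) : GaugeConfig d L (Matrix.specialUnitaryGroup (Fin 2) ℂ)) (e.1 + a, e.2)) := by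
  funext e
  simp only [Pi.mul_apply, add_sub_cancel_right, Prod.mk.eta]

omit [NeZero L] in
/-- For a translation-invariant `S̃`, the action along the drift from `V·a` is the action along the
drift from `V` precomposed with the momentum re-indexing `p ↦ p·(−a)`. -/
theorem ftAction_drift_translate (a : Site d L) {St : GaugeConfig d L (Matrix.specialUnitaryGroup (Fin 2) ℂ) → ℝ}
    (hSt : ∀ V : GaugeConfig d L (Matrix.specialUnitaryGroup (Fin 2) ℂ), St (fun e : Edge d L => V (e.1 + a, e.2)) = St V) (c : ℝ) (V : GaugeConfig d L (Matrix.specialUnitaryGroup (Fin 2) ℂ)) :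
    (fun p : ((Edge d L × Fin 3) → ℝ) => St ((fun ℓ : Edge d L => gaussUnit (toLp 2
          ![Real.cos (c * Real.sqrt (p (ℓ, 0) ^ 2 + p (ℓ, 1) ^ 2 + p (ℓ, 2) ^ 2)),
            c * Real.sinc (c * Real.sqrt (p (ℓ, 0) ^ 2 + p (ℓ, 1) ^ 2 + p (ℓ, 2) ^ 2)) * p (ℓ, 0),
            c * Real.sinc (c * Real.sqrt (p (ℓ, 0) ^ 2 + p (ℓ, 1) ^ 2 + p (ℓ, 2) ^ 2)) * p (ℓ, 1),
            c * Real.sinc (c * Real.sqrt (p (ℓ, 0) ^ 2 + p (ℓ, 1) ^ 2 + p (ℓ, 2) ^ 2)) * p (ℓ, 2)])) * (fun e : Edge d L => V (e.1 + a, e.2)))) =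
      (fun p : ((Edge d L × Fin 3) → ℝ) => St ((fun ℓ : Edge d L => gaussUnit (toLp 2
          ![Real.cos (c * Real.sqrt (p (ℓ, 0) ^ 2 + p (ℓ, 1) ^ 2 + p (ℓ, 2) ^ 2)),
            c * Real.sinc (c * Real.sqrt (p (ℓ, 0) ^ 2 + p (ℓ, 1) ^ 2 + p (ℓ, 2) ^ 2)) * p (ℓ, 0),
            c * Real.sinc (c * Real.sqrt (p (ℓ, 0) ^ 2 + p (ℓ, 1) ^ 2 + p (ℓ, 2) ^ 2)) * p (ℓ, 1),
            c * Real.sinc (c * Real.sqrt (p (ℓ, 0) ^ 2 + p (ℓ, 1) ^ 2 + p (ℓ, 2) ^ 2)) * p (ℓ, 2)])) * V)) ∘ (fun p : ((Edge d L × Fin 3) → ℝ) => (fun q : Edge d L × Fin 3 => p ((q.1.1 - a, q.1.2), q.2))) := by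
  funext p
  rw [Function.comp_apply, su2Drift_translate_mul a c p V]
  exact hSt _

omit [NeZero L] in
/-- The momentum re-indexing sends the coordinate vector `e_q` to `e_(q·a)`. -/
theorem single_translate (a : Site d L) (q : Edge d L × Fin 3) :
    (fun i : Edge d L × Fin 3 => (Pi.single q (1 : ℝ) : ((Edge d L × Fin 3) → ℝ)) ((i.1.1 - a, i.1.2), i.2)) =
      (Pi.single ((q.1.1 + a, q.1.2), q.2) (1 : ℝ) : ((Edge d L × Fin 3) → ℝ)) := by
  funext i
  by_cases h : i = ((q.1.1 + a, q.1.2), q.2)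
  · subst h
    simp only [add_sub_cancel_right, Prod.mk.eta, Pi.single_eq_same]
  · rw [Pi.single_eq_of_ne h, Pi.single_eq_of_ne]
    intro h'
    apply h
    obtain ⟨⟨x, μ⟩, j⟩ := i
    obtain ⟨⟨y, ν⟩, k⟩ := q
    simp only [Prod.mk.injEq] at h' ⊢
    obtain ⟨⟨hx, hμ⟩, hj⟩ := h'
    exact ⟨⟨by rw [← hx, sub_add_cancel], hμ⟩, hj⟩

/-- **The exact force of a translation-invariant action is translation covariant**:
`g_κ (V·a) = (g_κ V)·a` for `g_κ V (q) = κ · fderiv ℝ (p ↦ S̃(exp(c p)·V)) 0 (e_q)`. -/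
theorem su2ExactForce_translate (a : Site d L) {St : GaugeConfig d L (Matrix.specialUnitaryGroup (Fin 2) ℂ) → ℝ}
    (hSt : ∀ V : GaugeConfig d L (Matrix.specialUnitaryGroup (Fin 2) ℂ), St (fun e : Edge d L => V (e.1 + a, e.2)) = St V) (c κ : ℝ) (V : GaugeConfig d L (Matrix.specialUnitaryGroup (Fin 2) ℂ)) :
    (fun q : Edge d L × Fin 3 => κ * fderiv ℝ (fun p : ((Edge d L × Fin 3) → ℝ) => St ((fun ℓ : Edge d L => gaussUnit (toLp 2
          ![Real.cos (c * Real.sqrt (p (ℓ, 0) ^ 2 + p (ℓ, 1) ^ 2 + p (ℓ, 2) ^ 2)),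
            c * Real.sinc (c * Real.sqrt (p (ℓ, 0) ^ 2 + p (ℓ, 1) ^ 2 + p (ℓ, 2) ^ 2)) * p (ℓ, 0),
            c * Real.sinc (c * Real.sqrt (p (ℓ, 0) ^ 2 + p (ℓ, 1) ^ 2 + p (ℓ, 2) ^ 2)) * p (ℓ, 1),
            c * Real.sinc (c * Real.sqrt (p (ℓ, 0) ^ 2 + p (ℓ, 1) ^ 2 + p (ℓ, 2) ^ 2)) * p (ℓ, 2)])) * (fun e : Edge d L => V (e.1 + a, e.2)))) 0 (Pi.single q 1)) =
      (fun q : Edge d L × Fin 3 => (fun q : Edge d L × Fin 3 => κ * fderiv ℝ (fun p : ((Edge d L × Fin 3) → ℝ) => St ((fun ℓ : Edge d L => gaussUnit (toLp 2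
          ![Real.cos (c * Real.sqrt (p (ℓ, 0) ^ 2 + p (ℓ, 1) ^ 2 + p (ℓ, 2) ^ 2)),
            c * Real.sinc (c * Real.sqrt (p (ℓ, 0) ^ 2 + p (ℓ, 1) ^ 2 + p (ℓ, 2) ^ 2)) * p (ℓ, 0),
            c * Real.sinc (c * Real.sqrt (p (ℓ, 0) ^ 2 + p (ℓ, 1) ^ 2 + p (ℓ, 2) ^ 2)) * p (ℓ, 1),
            c * Real.sinc (c * Real.sqrt (p (ℓ, 0) ^ 2 + p (ℓ, 1) ^ 2 + p (ℓ, 2) ^ 2)) * p (ℓ, 2)])) * V)) 0 (Pi.single q 1)) ((q.1.1 + a, q.1.2), q.2)) := by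
  let Le : ((Edge d L × Fin 3) → ℝ) ≃ₗ[ℝ] ((Edge d L × Fin 3) → ℝ) :=
    { toFun := fun p => (fun q : Edge d L × Fin 3 => p ((q.1.1 - a, q.1.2), q.2)),
      invFun := fun p => (fun q : Edge d L × Fin 3 => p ((q.1.1 + a, q.1.2), q.2)),
      map_add' := fun p p' => rfl,
      map_smul' := fun r p => rfl,
      left_inv := fun p => funext fun q => by simp only [add_sub_cancel_right, Prod.mk.eta],
      right_inv := fun p => funext fun q => by simp only [sub_add_cancel, Prod.mk.eta] }
  let Lc : ((Edge d L × Fin 3) → ℝ) ≃L[ℝ] ((Edge d L × Fin 3) → ℝ) := Le.toContinuousLinearEquiv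
  have hLc : ∀ p : ((Edge d L × Fin 3) → ℝ), Lc p = (fun q : Edge d L × Fin 3 => p ((q.1.1 - a, q.1.2), q.2)) := fun p => rfl
  have hcomp : (fun p : ((Edge d L × Fin 3) → ℝ) => St ((fun ℓ : Edge d L => gaussUnit (toLp 2
          ![Real.cos (c * Real.sqrt (p (ℓ, 0) ^ 2 + p (ℓ, 1) ^ 2 + p (ℓ, 2) ^ 2)),
            c * Real.sinc (c * Real.sqrt (p (ℓ, 0) ^ 2 + p (ℓ, 1) ^ 2 + p (ℓ, 2) ^ 2)) * p (ℓ, 0),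
            c * Real.sinc (c * Real.sqrt (p (ℓ, 0) ^ 2 + p (ℓ, 1) ^ 2 + p (ℓ, 2) ^ 2)) * p (ℓ, 1),
            c * Real.sinc (c * Real.sqrt (p (ℓ, 0) ^ 2 + p (ℓ, 1) ^ 2 + p (ℓ, 2) ^ 2)) * p (ℓ, 2)])) * (fun e : Edge d L => V (e.1 + a, e.2)))) =
      (fun p : ((Edge d L × Fin 3) → ℝ) => St ((fun ℓ : Edge d L => gaussUnit (toLp 2
          ![Real.cos (c * Real.sqrt (p (ℓ, 0) ^ 2 + p (ℓ, 1) ^ 2 + p (ℓ, 2) ^ 2)),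
            c * Real.sinc (c * Real.sqrt (p (ℓ, 0) ^ 2 + p (ℓ, 1) ^ 2 + p (ℓ, 2) ^ 2)) * p (ℓ, 0),
            c * Real.sinc (c * Real.sqrt (p (ℓ, 0) ^ 2 + p (ℓ, 1) ^ 2 + p (ℓ, 2) ^ 2)) * p (ℓ, 1),
            c * Real.sinc (c * Real.sqrt (p (ℓ, 0) ^ 2 + p (ℓ, 1) ^ 2 + p (ℓ, 2) ^ 2)) * p (ℓ, 2)])) * V)) ∘ (⇑Lc) := by
    rw [ftAction_drift_translate a hSt c V]
    rfl
  funext q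
  beta_reduce
  rw [hcomp, Lc.comp_right_fderiv, ContinuousLinearEquiv.map_zero, ContinuousLinearMap.comp_apply]
  change κ * fderiv ℝ (fun p : ((Edge d L × Fin 3) → ℝ) => St ((fun ℓ : Edge d L => gaussUnit (toLp 2
          ![Real.cos (c * Real.sqrt (p (ℓ, 0) ^ 2 + p (ℓ, 1) ^ 2 + p (ℓ, 2) ^ 2)),
            c * Real.sinc (c * Real.sqrt (p (ℓ, 0) ^ 2 + p (ℓ, 1) ^ 2 + p (ℓ, 2) ^ 2)) * p (ℓ, 0),
            c * Real.sinc (c * Real.sqrt (p (ℓ, 0) ^ 2 + p (ℓ, 1) ^ 2 + p (ℓ, 2) ^ 2)) * p (ℓ, 1),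
            c * Real.sinc (c * Real.sqrt (p (ℓ, 0) ^ 2 + p (ℓ, 1) ^ 2 + p (ℓ, 2) ^ 2)) * p (ℓ, 2)])) * V)) 0 (Lc (Pi.single q 1)) = _
  rw [hLc, single_translate a q]

/-- **The engine's `SU(2)` FT-HMC kernel with the exact-gradient force of `S̃ = S∘F − log J` commutes
with every lattice translation** (translation-equivariant member, translation-invariant measurable
`J`, `S`, continuous `S̃`; any `c`, `κ`, `n`) — no force hypothesis left. -/
theorem su2_fthmc_exactForce_conjKernel_translate (a : Site d L)
    (F : GaugeConfig d L (Matrix.specialUnitaryGroup (Fin 2) ℂ) ≃ᵐ GaugeConfig d L (Matrix.specialUnitaryGroup (Fin 2) ℂ)) (hF : ∀ V : GaugeConfig d L (Matrix.specialUnitaryGroup (Fin 2) ℂ), F (fun e : Edge d L => V (e.1 + a, e.2)) = (fun e : Edge d L => (F V) (e.1 + a, e.2)))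
    {J : GaugeConfig d L (Matrix.specialUnitaryGroup (Fin 2) ℂ) → ℝ} (hJm : Measurable J) (hJ : ∀ V : GaugeConfig d L (Matrix.specialUnitaryGroup (Fin 2) ℂ), J (fun e : Edge d L => V (e.1 + a, e.2)) = J V)
    {S : GaugeConfig d L (Matrix.specialUnitaryGroup (Fin 2) ℂ) → ℝ} (hS : Measurable S) (hSi : ∀ V : GaugeConfig d L (Matrix.specialUnitaryGroup (Fin 2) ℂ), S (fun e : Edge d L => V (e.1 + a, e.2)) = S V)
    (hSc : Continuous fun W : GaugeConfig d L (Matrix.specialUnitaryGroup (Fin 2) ℂ) => S (F W) - Real.log (J W)) (c κ : ℝ) (n : ℕ) :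
    conjKernel
      (conjKernel
        (refreshUpdate
          (involMH
            (⇑((flip : Equiv.Perm (GaugeConfig d L (Matrix.specialUnitaryGroup (Fin 2) ℂ) × ((Edge d L × Fin 3) → ℝ))) *
                leapfrog (mulDrift fun p : ((Edge d L × Fin 3) → ℝ) =>
                  fun ℓ : Edge d L => gaussUnit (toLp 2
          ![Real.cos (c * Real.sqrt (p (ℓ, 0) ^ 2 + p (ℓ, 1) ^ 2 + p (ℓ, 2) ^ 2)),
            c * Real.sinc (c * Real.sqrt (p (ℓ, 0) ^ 2 + p (ℓ, 1) ^ 2 + p (ℓ, 2) ^ 2)) * p (ℓ, 0),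
            c * Real.sinc (c * Real.sqrt (p (ℓ, 0) ^ 2 + p (ℓ, 1) ^ 2 + p (ℓ, 2) ^ 2)) * p (ℓ, 1),
            c * Real.sinc (c * Real.sqrt (p (ℓ, 0) ^ 2 + p (ℓ, 1) ^ 2 + p (ℓ, 2) ^ 2)) * p (ℓ, 2)])) (fun V : GaugeConfig d L (Matrix.specialUnitaryGroup (Fin 2) ℂ) => (fun q : Edge d L × Fin 3 => κ * fderiv ℝ (fun p : ((Edge d L × Fin 3) → ℝ) => (fun W : GaugeConfig d L (Matrix.specialUnitaryGroup (Fin 2) ℂ) => S (F W) - Real.log (J W)) ((fun ℓ : Edge d L => gaussUnit (toLp 2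
          ![Real.cos (c * Real.sqrt (p (ℓ, 0) ^ 2 + p (ℓ, 1) ^ 2 + p (ℓ, 2) ^ 2)),
            c * Real.sinc (c * Real.sqrt (p (ℓ, 0) ^ 2 + p (ℓ, 1) ^ 2 + p (ℓ, 2) ^ 2)) * p (ℓ, 0),
            c * Real.sinc (c * Real.sqrt (p (ℓ, 0) ^ 2 + p (ℓ, 1) ^ 2 + p (ℓ, 2) ^ 2)) * p (ℓ, 1),
            c * Real.sinc (c * Real.sqrt (p (ℓ, 0) ^ 2 + p (ℓ, 1) ^ 2 + p (ℓ, 2) ^ 2)) * p (ℓ, 2)])) * V)) 0 (Pi.single q 1))) ^ n))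
            (measurable_flip_leapfrog_pow (measurable_mulDrift (measurable_su2Drift c)) (measurable_su2ExactForce hSc c κ) n)
            fun z : GaugeConfig d L (Matrix.specialUnitaryGroup (Fin 2) ℂ) × ((Edge d L × Fin 3) → ℝ) =>
              (S (F z.1) - Real.log (J z.1)) + ∑ i, z.2 i ^ 2 / 2)
          ((((volume : Measure ((Edge d L × Fin 3) → ℝ)).withDensity
                  fun p => ENNReal.ofReal (Real.exp (-(∑ i, p i ^ 2 / 2)))) Set.univ)⁻¹ •
              (volume : Measure ((Edge d L × Fin 3) → ℝ)).withDensity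
                fun p => ENNReal.ofReal (Real.exp (-(∑ i, p i ^ 2 / 2)))))
        F)
      ({ toFun := fun V : GaugeConfig d L (Matrix.specialUnitaryGroup (Fin 2) ℂ) => (fun e : Edge d L => V (e.1 + a, e.2)),
         invFun := fun V : GaugeConfig d L (Matrix.specialUnitaryGroup (Fin 2) ℂ) => (fun e : Edge d L => V (e.1 - a, e.2)),
         left_inv := fun V => funext fun e => by simp only [sub_add_cancel],
         right_inv := fun V => funext fun e => by simp only [add_sub_cancel_right],
         measurable_toFun := measurable_pi_lambda _ fun e => measurable_pi_apply _,
         measurable_invFun := measurable_pi_lambda _ fun e => measurable_pi_apply _ } : GaugeConfig d L (Matrix.specialUnitaryGroup (Fin 2) ℂ) ≃ᵐ GaugeConfig d L (Matrix.specialUnitaryGroup (Fin 2) ℂ)) =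
      (conjKernel
        (refreshUpdate
          (involMH
            (⇑((flip : Equiv.Perm (GaugeConfig d L (Matrix.specialUnitaryGroup (Fin 2) ℂ) × ((Edge d L × Fin 3) → ℝ))) *
                leapfrog (mulDrift fun p : ((Edge d L × Fin 3) → ℝ) =>
                  fun ℓ : Edge d L => gaussUnit (toLp 2
          ![Real.cos (c * Real.sqrt (p (ℓ, 0) ^ 2 + p (ℓ, 1) ^ 2 + p (ℓ, 2) ^ 2)),
            c * Real.sinc (c * Real.sqrt (p (ℓ, 0) ^ 2 + p (ℓ, 1) ^ 2 + p (ℓ, 2) ^ 2)) * p (ℓ, 0),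
            c * Real.sinc (c * Real.sqrt (p (ℓ, 0) ^ 2 + p (ℓ, 1) ^ 2 + p (ℓ, 2) ^ 2)) * p (ℓ, 1),
            c * Real.sinc (c * Real.sqrt (p (ℓ, 0) ^ 2 + p (ℓ, 1) ^ 2 + p (ℓ, 2) ^ 2)) * p (ℓ, 2)])) (fun V : GaugeConfig d L (Matrix.specialUnitaryGroup (Fin 2) ℂ) => (fun q : Edge d L × Fin 3 => κ * fderiv ℝ (fun p : ((Edge d L × Fin 3) → ℝ) => (fun W : GaugeConfig d L (Matrix.specialUnitaryGroup (Fin 2) ℂ) => S (F W) - Real.log (J W)) ((fun ℓ : Edge d L => gaussUnit (toLp 2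
          ![Real.cos (c * Real.sqrt (p (ℓ, 0) ^ 2 + p (ℓ, 1) ^ 2 + p (ℓ, 2) ^ 2)),
            c * Real.sinc (c * Real.sqrt (p (ℓ, 0) ^ 2 + p (ℓ, 1) ^ 2 + p (ℓ, 2) ^ 2)) * p (ℓ, 0),
            c * Real.sinc (c * Real.sqrt (p (ℓ, 0) ^ 2 + p (ℓ, 1) ^ 2 + p (ℓ, 2) ^ 2)) * p (ℓ, 1),
            c * Real.sinc (c * Real.sqrt (p (ℓ, 0) ^ 2 + p (ℓ, 1) ^ 2 + p (ℓ, 2) ^ 2)) * p (ℓ, 2)])) * V)) 0 (Pi.single q 1))) ^ n))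
            (measurable_flip_leapfrog_pow (measurable_mulDrift (measurable_su2Drift c)) (measurable_su2ExactForce hSc c κ) n)
            fun z : GaugeConfig d L (Matrix.specialUnitaryGroup (Fin 2) ℂ) × ((Edge d L × Fin 3) → ℝ) =>
              (S (F z.1) - Real.log (J z.1)) + ∑ i, z.2 i ^ 2 / 2)
          ((((volume : Measure ((Edge d L × Fin 3) → ℝ)).withDensity
                  fun p => ENNReal.ofReal (Real.exp (-(∑ i, p i ^ 2 / 2)))) Set.univ)⁻¹ •
              (volume : Measure ((Edge d L × Fin 3) → ℝ)).withDensity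
                fun p => ENNReal.ofReal (Real.exp (-(∑ i, p i ^ 2 / 2)))))
        F) := by
  have hSt : ∀ V : GaugeConfig d L (Matrix.specialUnitaryGroup (Fin 2) ℂ), (fun W : GaugeConfig d L (Matrix.specialUnitaryGroup (Fin 2) ℂ) => S (F W) - Real.log (J W)) (fun e : Edge d L => V (e.1 + a, e.2)) =
      (fun W : GaugeConfig d L (Matrix.specialUnitaryGroup (Fin 2) ℂ) => S (F W) - Real.log (J W)) V := fun V => by
    beta_reduce
    rw [hF V, hSi, hJ V]
  exact su2_fthmc_conjKernel_translate a F hF hJm hJ hS hSi c (measurable_su2ExactForce hSc c κ)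
    (fun V => su2ExactForce_translate a (St := fun W : GaugeConfig d L (Matrix.specialUnitaryGroup (Fin 2) ℂ) => S (F W) - Real.log (J W)) hSt c κ V) n

end Summit.Ventures.LatticeQCDFlow.Exactness
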